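import Literature.NumberTheory.PAdicHodge.AinfRamifiedEtaPeriodAdd
import Literature.NumberTheory.PAdicHodge.AinfWeierstrassQuasiPeriodTwoCocycle
import HarnessLib

/-!
# The integral addition cocycle of `η₀` over the ramified base `𝒪_D` is a 2-cocycle, at points of `𝔫_𝒪 ⊂ A_inf(𝒪)`

Topic `Literature/NumberTheory/PAdicHodge`; namespace `Literature.NumberTheory.PAdicHodge.AinfRamTop`. The ramified twin of
`AinfWeierstrassQuasiPeriodTwoCocycle` §2–§3 (the generic §1 there, `WeierstrassCurve.formalQuasiPeriodCocycle_two_cocycle` over any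
`ℚ`-algebra, is reused): for `W` over `CoeffDisc D = 𝒪_D` the integral cocycle `C = cocycle W ∈ 𝒪_D⟦u, v⟧` of
`AinfRamifiedEtaPeriodAdd` (`C ⊗ F = C₀ = η₀(u ⊕ v) − η₀(u) − η₀(v)`) satisfies
`C(F(u,v), w) + C(u, v) = C(u, F(v,w)) + C(v, w)` in `𝒪_D⟦u, v, w⟧` (`cocycle_two_cocycle`, by injectivity of `𝒪_D⟦·⟧ → F⟦·⟧`),
hence at points `a, b, c ∈ 𝔫_𝒪`: `C(a ⊕_W b, c) + C(a, b) = C(a, b ⊕_W c) + C(b, c)` in `A_inf(𝒪)` (`cocycleAt_two_cocycle`); and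
`σ C(a, b) = C(σa, σb)` (`gal_cocycleAt`). Input of the η-integrating element of the Kummer cocycle over the ramified base
(`AinfRamifiedKummerIntegralEta`). THEOREMS ONLY; no `sorry`. BSD / K★ are not proved by any of this.

References: [Katz1981CrystallineDieudonne] §5.1; [SilvermanAEC2009] IV.2.1–IV.2.3; [FontaineAsterisque223III] Exp. II §1.2;
[CasselsFrohlichANT1967] Ch. VI §3.2.
-/

noncomputable section

open Ideal Filter Topology Field WittVector MvPowerSeries ValuativeRel

namespace Literature.NumberTheory.PAdicHodge

open Literature.NumberTheory.GaloisRepresentations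
open Literature.NumberTheory.GaloisRepresentations.IsNonarchimedeanLocalField
open Literature.NumberTheory.GaloisRepresentations.LubinTate
open Literature.NumberTheory.EllipticCurves

namespace AinfRamTop

variable {F : Type} [Field F] [ValuativeRel F] [TopologicalSpace F] [IsNonarchimedeanLocalField F] [CharZero F]
  {p : ℕ} [Fact p.Prime] [Fact (¬ IsUnit (p : integerC F))] [IsAdicComplete (Ideal.span {(p : integerC F)}) (integerC F)]
  {hp : valuation F p < 1} {D : EisensteinRoot F p hp} {hθ : Function.Surjective (fontaineTheta (integerC F) p)}
  (W : WeierstrassCurve (EisensteinRoot.CoeffDisc D))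

/-! ## §1 The 2-cocycle identity for the integral cocycle `cocycle W ∈ 𝒪_D⟦u, v⟧` -/

/-- Base change of `C` along a pair: `(C(g, h)) ⊗ F = C₀(g ⊗ F, h ⊗ F)`. [cite: Katz1981CrystallineDieudonne, §5.1] -/
theorem map_subst_pair_cocycle {σ : Type*} {g h : MvPowerSeries σ (EisensteinRoot.CoeffDisc D)} (hg : MvPowerSeries.constantCoeff g = 0)
    (hh : MvPowerSeries.constantCoeff h = 0) :
    MvPowerSeries.map (EisensteinRoot.CoeffDisc.toFieldCoeff D hθ) (MvPowerSeries.subst ![g, h] (cocycle (hθ := hθ) W)) =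
      MvPowerSeries.subst ![MvPowerSeries.map (EisensteinRoot.CoeffDisc.toFieldCoeff D hθ) g,
          MvPowerSeries.map (EisensteinRoot.CoeffDisc.toFieldCoeff D hθ) h]
        (W.map (EisensteinRoot.CoeffDisc.toFieldCoeff D hθ)).formalQuasiPeriodCocycle := by
  rw [MvPowerSeries.map_subst (WeierstrassCurve.hasSubst_pair hg hh), map_cocycle]
  congr 1
  funext k
  fin_cases k <;> rfl

/-- **The integral addition cocycle over `𝒪_D` is a 2-cocycle**: `C(F(u,v), w) + C(u, v) = C(u, F(v,w)) + C(v, w)` in `𝒪_D⟦u, v, w⟧`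
(from the identity over the coefficient field by injectivity of `𝒪_D⟦u,v,w⟧ → F⟦u,v,w⟧`). [cite: Katz1981CrystallineDieudonne, §5.1] -/
theorem cocycle_two_cocycle :
    MvPowerSeries.subst ![MvPowerSeries.subst ![(MvPowerSeries.X 0 : MvPowerSeries (Fin 3) (EisensteinRoot.CoeffDisc D)), MvPowerSeries.X 1]
          W.formalGroupLaw, MvPowerSeries.X 2] (cocycle (hθ := hθ) W) +
        MvPowerSeries.subst ![(MvPowerSeries.X 0 : MvPowerSeries (Fin 3) (EisensteinRoot.CoeffDisc D)), MvPowerSeries.X 1]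
          (cocycle (hθ := hθ) W) =
      MvPowerSeries.subst ![(MvPowerSeries.X 0 : MvPowerSeries (Fin 3) (EisensteinRoot.CoeffDisc D)),
          MvPowerSeries.subst ![(MvPowerSeries.X 1 : MvPowerSeries (Fin 3) (EisensteinRoot.CoeffDisc D)), MvPowerSeries.X 2]
            W.formalGroupLaw] (cocycle (hθ := hθ) W) +
        MvPowerSeries.subst ![(MvPowerSeries.X 1 : MvPowerSeries (Fin 3) (EisensteinRoot.CoeffDisc D)), MvPowerSeries.X 2]
          (cocycle (hθ := hθ) W) := by
  apply WeierstrassCurve.mvPowerSeries_map_injective (φ := EisensteinRoot.CoeffDisc.toFieldCoeff D hθ)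
    (EisensteinRoot.CoeffDisc.toFieldCoeff_injective D hθ)
  rw [map_add, map_add,
    map_subst_pair_cocycle W (W.constantCoeff_subst_X_pair_formalGroupLaw 0 1) (MvPowerSeries.constantCoeff_X 2),
    map_subst_pair_cocycle W (MvPowerSeries.constantCoeff_X 0) (MvPowerSeries.constantCoeff_X 1),
    map_subst_pair_cocycle W (MvPowerSeries.constantCoeff_X 0) (W.constantCoeff_subst_X_pair_formalGroupLaw 1 2),
    map_subst_pair_cocycle W (MvPowerSeries.constantCoeff_X 1) (MvPowerSeries.constantCoeff_X 2),
    W.map_subst_pair_formalGroupLaw _ (MvPowerSeries.constantCoeff_X 0) (MvPowerSeries.constantCoeff_X 1),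
    W.map_subst_pair_formalGroupLaw _ (MvPowerSeries.constantCoeff_X 1) (MvPowerSeries.constantCoeff_X 2),
    MvPowerSeries.map_X, MvPowerSeries.map_X, MvPowerSeries.map_X]
  exact (W.map (EisensteinRoot.CoeffDisc.toFieldCoeff D hθ)).formalQuasiPeriodCocycle_two_cocycle

/-! ## §2 The 2-cocycle identity at points of `𝔫_𝒪`, and `Γ_F`-equivariance of `C(a, b)` -/

/-- Evaluating `F(zᵢ, zⱼ)` at `(a₀, a₁, a₂)` gives `aᵢ ⊕_W aⱼ`. [cite: CasselsFrohlichANT1967, Ch. VI §3.2] -/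
theorem evalPt_subst_X_pair_formalGroupLaw (i j : Fin 3) (x : Fin 3 → (nilTheta D hθ).toIdeal) :
    evalPt (nilTheta D hθ) (MvPowerSeries.subst ![(MvPowerSeries.X i : MvPowerSeries (Fin 3) (EisensteinRoot.CoeffDisc D)),
        MvPowerSeries.X j] W.formalGroupLaw) (W.constantCoeff_subst_X_pair_formalGroupLaw i j) x = addW W (x i) (x j) := by
  have ha : ∀ s : Fin 2, ((![(MvPowerSeries.X i : MvPowerSeries (Fin 3) (EisensteinRoot.CoeffDisc D)), MvPowerSeries.X j]) s).constantCoeff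
      = 0 := fun s => by fin_cases s <;> exact MvPowerSeries.constantCoeff_X _
  rw [evalPt_subst (nilTheta D hθ) ha W.formalGroupLaw W.constantCoeff_formalGroupLaw, addW]
  congr 1
  funext s
  fin_cases s
  · exact evalPt_X (nilTheta D hθ) i x
  · exact evalPt_X (nilTheta D hθ) j x

/-- Evaluating `C(f, g)` at a point: `C(f,g)(x) = C(f(x), g(x))`. [cite: Katz1981CrystallineDieudonne, §5.1] -/
theorem evalPt_subst_pair_cocycle {f g : MvPowerSeries (Fin 3) (EisensteinRoot.CoeffDisc D)} (hf : MvPowerSeries.constantCoeff f = 0)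
    (hg : MvPowerSeries.constantCoeff g = 0) (x : Fin 3 → (nilTheta D hθ).toIdeal)
    (h : MvPowerSeries.constantCoeff (MvPowerSeries.subst ![f, g] (cocycle (hθ := hθ) W)) = 0) :
    (evalPt (nilTheta D hθ) (MvPowerSeries.subst ![f, g] (cocycle (hθ := hθ) W)) h x : AinfRamTop D) =
      cocycleAt W hθ (evalPt (nilTheta D hθ) f hf x) (evalPt (nilTheta D hθ) g hg x) := by
  have ha : ∀ s : Fin 2, ((![f, g]) s).constantCoeff = 0 := fun s => by fin_cases s; exacts [hf, hg]
  rw [evalPt_subst (nilTheta D hθ) ha (cocycle (hθ := hθ) W) (constantCoeff_cocycle W), cocycleAt]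
  congr 2
  funext s
  fin_cases s <;> rfl

/-- **The 2-cocycle identity at points: `C(a ⊕_W b, c) + C(a, b) = C(a, b ⊕_W c) + C(b, c)` in `A_inf(𝒪)`** for
`a, b, c ∈ 𝔫_𝒪`. [cite: Katz1981CrystallineDieudonne, §5.1] [cite: FontaineAsterisque223III, Exp. II §1.2] -/
theorem cocycleAt_two_cocycle (a b c : (nilTheta D hθ).toIdeal) :
    cocycleAt W hθ (addW W a b) c + cocycleAt W hθ a b = cocycleAt W hθ a (addW W b c) + cocycleAt W hθ b c := by
  set x : Fin 3 → (nilTheta D hθ).toIdeal := ![a, b, c] with hx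
  have hX : ∀ i : Fin 3, MvPowerSeries.constantCoeff (MvPowerSeries.X i : MvPowerSeries (Fin 3) (EisensteinRoot.CoeffDisc D)) = 0 :=
    fun i => MvPowerSeries.constantCoeff_X i
  have hP : ∀ i j : Fin 3, MvPowerSeries.constantCoeff (MvPowerSeries.subst
      ![(MvPowerSeries.X i : MvPowerSeries (Fin 3) (EisensteinRoot.CoeffDisc D)), MvPowerSeries.X j] W.formalGroupLaw) = 0 :=
    fun i j => W.constantCoeff_subst_X_pair_formalGroupLaw i j
  have hC := constantCoeff_cocycle (hθ := hθ) W
  have h1 : MvPowerSeries.constantCoeff (MvPowerSeries.subst ![MvPowerSeries.subst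
      ![(MvPowerSeries.X 0 : MvPowerSeries (Fin 3) (EisensteinRoot.CoeffDisc D)), MvPowerSeries.X 1] W.formalGroupLaw, MvPowerSeries.X 2]
      (cocycle (hθ := hθ) W)) = 0 :=
    constantCoeff_subst_zero (fun s => by fin_cases s; exacts [hP 0 1, hX 2]) hC
  have h2 : MvPowerSeries.constantCoeff (MvPowerSeries.subst
      ![(MvPowerSeries.X 0 : MvPowerSeries (Fin 3) (EisensteinRoot.CoeffDisc D)), MvPowerSeries.X 1] (cocycle (hθ := hθ) W)) = 0 :=
    constantCoeff_subst_zero (fun s => by fin_cases s; exacts [hX 0, hX 1]) hC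
  have h3 : MvPowerSeries.constantCoeff (MvPowerSeries.subst ![(MvPowerSeries.X 0 : MvPowerSeries (Fin 3) (EisensteinRoot.CoeffDisc D)),
      MvPowerSeries.subst ![(MvPowerSeries.X 1 : MvPowerSeries (Fin 3) (EisensteinRoot.CoeffDisc D)), MvPowerSeries.X 2] W.formalGroupLaw]
      (cocycle (hθ := hθ) W)) = 0 :=
    constantCoeff_subst_zero (fun s => by fin_cases s; exacts [hX 0, hP 1 2]) hC
  have h4 : MvPowerSeries.constantCoeff (MvPowerSeries.subst
      ![(MvPowerSeries.X 1 : MvPowerSeries (Fin 3) (EisensteinRoot.CoeffDisc D)), MvPowerSeries.X 2] (cocycle (hθ := hθ) W)) = 0 :=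
    constantCoeff_subst_zero (fun s => by fin_cases s; exacts [hX 1, hX 2]) hC
  -- evaluate the formal identity at `x = (a, b, c)`
  have e := congrArg (MvPowerSeries.aeval ((nilTheta D hθ).hasEval x)) (cocycle_two_cocycle (hθ := hθ) W)
  simp only [map_add] at e
  rw [← coe_evalPt (nilTheta D hθ) _ h1, ← coe_evalPt (nilTheta D hθ) _ h2, ← coe_evalPt (nilTheta D hθ) _ h3,
    ← coe_evalPt (nilTheta D hθ) _ h4,
    evalPt_subst_pair_cocycle W (hP 0 1) (hX 2) x h1, evalPt_subst_pair_cocycle W (hX 0) (hX 1) x h2,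
    evalPt_subst_pair_cocycle W (hX 0) (hP 1 2) x h3, evalPt_subst_pair_cocycle W (hX 1) (hX 2) x h4,
    evalPt_subst_X_pair_formalGroupLaw W 0 1 x, evalPt_subst_X_pair_formalGroupLaw W 1 2 x,
    evalPt_X, evalPt_X, evalPt_X] at e
  simpa [hx] using e

/-- **`Γ_F`-equivariance of the evaluated cocycle: `σ C(a, b) = C(σa, σb)`** (`𝒪_D`-coefficients, fixed by `Γ_F`).
[cite: FontaineAsterisque223III, Exp. II §1.2] -/
theorem gal_cocycleAt (σ : absoluteGaloisGroup F) (a b : (nilTheta D hθ).toIdeal) :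
    gal D σ (cocycleAt W hθ a b) = cocycleAt W hθ ⟨gal D σ a, gal_mem_nilTheta σ a.2⟩ ⟨gal D σ b, gal_mem_nilTheta σ b.2⟩ := by
  rw [cocycleAt, cocycleAt]
  exact gal_evalPt σ (EisensteinRoot.gal_algebraMap_coeffDisc D σ) _ (constantCoeff_cocycle W) ![a, b]
    ![⟨gal D σ a, gal_mem_nilTheta σ a.2⟩, ⟨gal D σ b, gal_mem_nilTheta σ b.2⟩] fun i => by
      fin_cases i
      · rfl
      · rfl

end AinfRamTop

end Literature.NumberTheory.PAdicHodge

end
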